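import Literature.AnabelianGeometry.EtaleTheta.FrobenioidCyclotomicRigidityProjGalois
import Literature.AnabelianGeometry.EtaleTheta.Discharge.Sec5Prop55OfConnectedTemperoidLevelN
import Literature.AnabelianGeometry.EtaleTheta.Discharge.Sec5Prop55CoeffOfConnectedTemperoidLevelN
import Literature.AnabelianGeometry.EtaleTheta.Discharge.Sec5Thm56EndKnitLevelNProjPinGalois
import HarnessLib

/-!
# [EtTh] Prop. 5.5 at the genuine level-`N` data `ofConnectedTemperoidData h (RD.levelStub ιX) …`: the binders `hpre` / `hlift` / `hgeom` / `(e, he, hP)` / `hproj`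
# DISCHARGED under the two subquotient pins, ON THE v2 SUBQUOTIENT RECORD `ThetaSubquotientProjGalois` — PROOF-ONLY, proofs verbatim

S. Mochizuki, *The étale theta function and its Frobenioid-theoretic manifestations*, Publ. RIMS **45** (2009)
[cite: MochizukiEtTh2009, Prop 5.5 p.327–328 (PDF pp.101–102); §5 p.327 (PDF p.101); §2 p.45–46; §5 p.327 (PDF p.101) «these subquotients determine subquotients `Aut_D(D) ↠ Aut^Θ_D(D)`»].
abc-iut cell, layer L2, seat abc-iut-w6-d020 (gen 7), row «(w4-S) V1→V2 PORT — deep EndKnit*/AllLeavesV3*/KummerComparisonInputsLevel*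
heads» (abc-iut-L2-lead gen 7 R957; VNEXT-CENSUS-L2 §G5 add. 11 standing row «(w4)»), layer S5e = `Sec5Prop55OfConnectedTemperoidLevelN` / `Sec5Prop55CoeffOfConnectedTemperoidLevelN` (abc-iut-w4-d042; section-variable `P`).

WHY.  abc-iut-w4-d042's level-`N` binder producers `hpre_levelN` / `hlift_levelN` / `hgeom_levelN` (pin `hPpre`) and `exists_coeffMap_levelN_of_pin` /
`hproj_levelN_of_pin(_base)` (pins `hPpre`, `hPproj_pin`) are stated over a SECTION VARIABLE `(P : ThetaSubquotientProj (ofConnectedTemperoidData h (RD.levelStub ιX) …))`;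
both pins hold BY CONSTRUCTION for abc-iut-w6-d079's pinned v2 term (p486065 `exists_thetaSubquotientProjGalois_pinned_ofThetaSettingDataQ` /
`RigidData.nonempty_thetaSubquotientProjGalois_of_stub_eq_levelStub`).  These producers bind
abc-iut-L2-t4's v1 record `(P : ThetaSubquotientProj 𝔉)` asks `proj_surjective` at EVERY base object and is EMPTY at the cell's root model for
`l` odd (abc-iut-L2-t9 p456572, kernel certificate p476337), so there each of these theorems quantifies over an empty type; abc-iut-w6-d079's v2
record `ThetaSubquotientProjGalois 𝔉 Gal` (p481123; surjectivity only at the objects singled out by `Gal`, as print uses it — Prop. 5.1 / Lemma 5.9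
run over connected GALOIS coverings) is INHABITED at every `ofSetting` carrier (p481568) and at every level stub of the junction data (p486065
`RigidData.nonempty_thetaSubquotientProjGalois_of_stub_eq_levelStub`); the v2 clauses `ThetaSubquotientProjGalois.IsKummerDetermined` /
`.CyclotomicRigidity` (p481123 / p484491) and the predicate twins `Thm56Sub.*Gal` (p484491) are the SAME formulas (they read `P` only through
`pre` / `proj` at `Base(B_N)`).

THIS FILE re-keys the listed theorems on the v2 record — binder `{Gal} (P : ThetaSubquotientProjGalois 𝔉 Gal)`, statements otherwise and
proofs VERBATIM (none of the source arguments uses `proj_surjective`), names = the originals with suffix `_galois`: 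
`hpre_levelN_galois`, `hlift_levelN_galois`, `hgeom_levelN_galois`, `exists_coeffMap_levelN_of_pin_galois`, `hproj_levelN_of_pin_galois` (the section variable
`P` of the sources becomes an explicit binder `(P : ThetaSubquotientProjGalois (…) Gal)` of each theorem, in the v1 argument position; `omit` pragmas kept;
`hproj_levelN_of_pin_base` is NOT twinned separately — it is literally abc-iut-w4-d042's `hproj_levelStub_of_pins`, whose twin `hproj_levelStub_of_pins_galois` landed in
this seat's `Sec5Thm56EndKnitLevelNProjPinGalois` (p492889) and is consumed BY NAME).
0 `def`s; no v1 file is edited or restated (the `P`-free producers of the sources are consumed BY NAME); the v1 heads are the `P.toGalois Gal`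
instances of these twins (abc-iut-w6-d079's `Iff.rfl` bridges `isKummerDetermined_toGalois_iff`, `cyclotomicRigidity_toGalois_iff`, `…Gal_toGalois_iff`).

HONEST FRAMING: a typing repair of the cell's OWN record (weaker quantifier on `P`, as print uses it); kernel-checked implications between typed
statements over abc-iut-L2-t4's assembled §5 data; every named leaf / binder of the v1 heads stays NAMED exactly as there; nothing of [EtTh]
(a refereed paper) is asserted; the existence of the data for an actual curve is not claimed; typed ≠ discharged; nothing here bears on [IUTchIII]
Cor. 3.12 — no side taken; nothing here asserts abc proved or refuted.
-/

noncomputable section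

namespace Literature.AnabelianGeometry.EtaleTheta

open CategoryTheory Opposite FrobenioidCyclotomicRigidity Literature.AlgebraicGeometry.Frobenioids
  Literature.AnabelianGeometry.SemiGraphs Literature.AnabelianGeometry.SemiGraphs.GaloisObjects

universe u₀ v₀ u v w w'

namespace ThetaFrobenioid

section LevelN

variable {K : Type u₀} [Field K] {X : SemiGraphs.TemperedArithmeticGroup.{u₀} K} {D₀ : Type u₀} [Category.{v₀} D₀]
  {V : FrdIMonoidStub.{max u₀ w'}} {T₀ : RealifiedDivisorMonoids (D₀ := D₀) V}
  {VD : FrdICatStub.{u₀ + 1, u₀, max u₀ w'} (ConnectedPart (BTemp X.Pi))}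
  {tf : TemperedFrobenioid T₀ (ConnectedPart (BTemp X.Pi)) VD} {hZ : tf.monoidType = MonoidType.Z}
  {hP : ∀ A : (ConnectedPart (BTemp X.Pi))ᵒᵖ, IsPerfect (tf.Φ.carrier A)}
  {NH : Subgroup (Field.absoluteGaloisGroup K) → tf.category → ℕ+ → Prop}
  {lv N : ℕ+} {l' : ℕ} {RD : RigidData.{max u₀ w'} N l'} {ιX : RD.PiX ≃ₜ* X.Pi}
  {pullFrac : ∀ {A A' : (BiKummerSetting.mkOfConnectedTemperoidYdd X tf hZ hP NH RD.toThetaEnvData ιX).C} (_ : A' ⟶ A),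
    (BiKummerSetting.mkOfConnectedTemperoidYdd X tf hZ hP NH RD.toThetaEnvData ιX).biratUnits A →
      (BiKummerSetting.mkOfConnectedTemperoidYdd X tf hZ hP NH RD.toThetaEnvData ιX).biratUnits A'}
  {θ : (BiKummerSetting.mkOfConnectedTemperoidYdd X tf hZ hP NH RD.toThetaEnvData ιX).biratUnits
    (BiKummerSetting.mkOfConnectedTemperoidYdd X tf hZ hP NH RD.toThetaEnvData ιX).Aodot}
  {Bl : (BiKummerSetting.mkOfConnectedTemperoidYdd X tf hZ hP NH RD.toThetaEnvData ιX).C}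
  {Pl : (BiKummerSetting.mkOfConnectedTemperoidYdd X tf hZ hP NH RD.toThetaEnvData ιX).FractionPair θ Bl}
  {Rl : (BiKummerSetting.mkOfConnectedTemperoidYdd X tf hZ hP NH RD.toThetaEnvData ιX).NthRoot θ Pl lv pullFrac}
  [RD.iotaN.range.Normal]
  (h : ModelFrobenioid.Hypotheses tf.divisorMonoid tf.ratFnFunctor) (odd_l : Odd (lv : ℕ))
  (R : (BiKummerSetting.mkOfConnectedTemperoidYdd X tf hZ hP NH RD.toThetaEnvData ιX).NthRoot Rl.root Rl.pair N pullFrac)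
  (K' : Type (max u₀ w')) [Field K'] (constEmb : K'ˣ →* tf.biratUnitsModel R.BN) (constEmb_injective : Function.Injective constEmb)
  (hinvc : ∀ g : Aut R.AN.base,
    pull tf.divisorMonoid g.hom (ModelFrobenioid.div R.pair.num) = ModelFrobenioid.div R.pair.num)
  (hinvp : ∀ y : RD.PiX, y ∈ RD.PiYdd →
    pull tf.divisorMonoid ((BiKummerSetting.mkOfConnectedTemperoidYdd X tf hZ hP NH RD.toThetaEnvData ιX).galoisSurj R.AN.base
      R.αData.isGalois (ιX y)).hom (ModelFrobenioid.div R.pair.den) = ModelFrobenioid.div R.pair.den)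
variable {Gal : ConnectedPart (BTemp X.Pi) → Prop}


/-- (v2 record `ThetaSubquotientProjGalois`; the v1 theorem `hpre_levelN` VERBATIM — binder type + twin names only.) **hpre DISCHARGED**: `k ∈ Π^tp_Ÿ ∩ (l·Δ_Θ) ⇒ ρ k ∈ P.pre`. [cite: MochizukiEtTh2009, Prop 5.5 p.327 (PDF p.101)] -/
theorem hpre_levelN_galois
    (P : ThetaSubquotientProjGalois (ofConnectedTemperoidData h (RD.levelStub ιX) odd_l R ιX K' constEmb constEmb_injective hinvc hinvp) Gal)
    (hPpre : P.pre R.BN.base =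
      (ThetaSubquotient.autPre (RD.qN ιX) RD.iotaN R.BN.base.obj).comap (Functor.mapAut R.BN.base (connectedObjects (BTemp X.Pi)).ι))
    : ∀ k : RD.PiYdd, (k : RD.PiX) ∈ RD.lDeltaTheta →
    rhoOfBiKummerData R ιX k ∈ P.pre R.BN.base := by
  intro k hk
  rw [hPpre]
  exact mapAut_rho_mem_autPre_of_coe_mem_lDeltaTheta R ιX k hk

omit [RD.iotaN.range.Normal] in
/-- **hlift DISCHARGED** (`A_⊙^bs := Ÿ`): an element of `H_{B_N} = ρ(Π^tp_Ÿ)` lying in `P.pre` lifts to `Π^tp_Ÿ ∩ (l·Δ_Θ)`.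
[cite: MochizukiEtTh2009, Prop 5.5 proof p.327–328 (PDF pp.101–102)] -/
theorem hlift_levelN_galois
    (P : ThetaSubquotientProjGalois (ofConnectedTemperoidData h (RD.levelStub ιX) odd_l R ιX K' constEmb constEmb_injective hinvc hinvp) Gal)
    (hPpre : P.pre R.BN.base =
      (ThetaSubquotient.autPre (RD.qN ιX) RD.iotaN R.BN.base.obj).comap (Functor.mapAut R.BN.base (connectedObjects (BTemp X.Pi)).ι))
    : ∀ a ∈ (ofConnectedTemperoidData h (RD.levelStub ιX) odd_l R ιX K' constEmb constEmb_injective hinvc hinvp).HB,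
    a ∈ P.pre R.BN.base → ∃ k : RD.PiYdd, (k : RD.PiX) ∈ RD.lDeltaTheta ∧ rhoOfBiKummerData R ιX k = a := by
  intro a ha hm
  change a ∈ RD.PiYdd.map (rhoOfBiKummerData R ιX) at ha
  obtain ⟨k₀, hk₀, rfl⟩ := ha
  rw [hPpre] at hm
  exact exists_lift_rho_PiYdd_lDeltaTheta R ⟨k₀, hk₀⟩ hm

omit [RD.iotaN.range.Normal] in
/-- **hgeom DISCHARGED**: `P.pre ≤ ρ(Ker(Π^tp_X ↠ G_K))` (`(l·Δ_Θ) ≤ Δ^tp_X`). [cite: MochizukiEtTh2009, §2 p.45] -/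
theorem hgeom_levelN_galois
    (P : ThetaSubquotientProjGalois (ofConnectedTemperoidData h (RD.levelStub ιX) odd_l R ιX K' constEmb constEmb_injective hinvc hinvp) Gal)
    (hPpre : P.pre R.BN.base =
      (ThetaSubquotient.autPre (RD.qN ιX) RD.iotaN R.BN.base.obj).comap (Functor.mapAut R.BN.base (connectedObjects (BTemp X.Pi)).ι))
    : P.pre R.BN.base ≤ RD.aug.ker.map (rhoOfBiKummerData R ιX) := by
  intro g hg
  rw [hPpre] at hg
  obtain ⟨k, hk, hρ⟩ := exists_mem_lDeltaTheta_mapAut_rho_eq_of_mem_autPre R ιX hg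
  exact ⟨k, (RD.lDeltaTheta_le hk).2, eq_of_mapAut_eq' R hρ⟩

end LevelN

section LevelNPin

variable {K : Type u₀} [Field K] {X : SemiGraphs.TemperedArithmeticGroup.{u₀} K} {D₀ : Type u₀} [Category.{v₀} D₀]
  {V : FrdIMonoidStub.{max u₀ w'}} {T₀ : RealifiedDivisorMonoids (D₀ := D₀) V}
  {VD : FrdICatStub.{u₀ + 1, u₀, max u₀ w'} (ConnectedPart (BTemp X.Pi))}
  {tf : TemperedFrobenioid T₀ (ConnectedPart (BTemp X.Pi)) VD} {hZ : tf.monoidType = MonoidType.Z}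
  {hP : ∀ A : (ConnectedPart (BTemp X.Pi))ᵒᵖ, IsPerfect (tf.Φ.carrier A)}
  {NH : Subgroup (Field.absoluteGaloisGroup K) → tf.category → ℕ+ → Prop}
  {lv N : ℕ+} {l' : ℕ} {RD : RigidData.{max u₀ w'} N l'} {ιX : RD.PiX ≃ₜ* X.Pi}
  {pullFrac : ∀ {A A' : (BiKummerSetting.mkOfConnectedTemperoidYdd X tf hZ hP NH RD.toThetaEnvData ιX).C} (_ : A' ⟶ A),
    (BiKummerSetting.mkOfConnectedTemperoidYdd X tf hZ hP NH RD.toThetaEnvData ιX).biratUnits A →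
      (BiKummerSetting.mkOfConnectedTemperoidYdd X tf hZ hP NH RD.toThetaEnvData ιX).biratUnits A'}
  {θ : (BiKummerSetting.mkOfConnectedTemperoidYdd X tf hZ hP NH RD.toThetaEnvData ιX).biratUnits
    (BiKummerSetting.mkOfConnectedTemperoidYdd X tf hZ hP NH RD.toThetaEnvData ιX).Aodot}
  {Bl : (BiKummerSetting.mkOfConnectedTemperoidYdd X tf hZ hP NH RD.toThetaEnvData ιX).C}
  {Pl : (BiKummerSetting.mkOfConnectedTemperoidYdd X tf hZ hP NH RD.toThetaEnvData ιX).FractionPair θ Bl}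
  {Rl : (BiKummerSetting.mkOfConnectedTemperoidYdd X tf hZ hP NH RD.toThetaEnvData ιX).NthRoot θ Pl lv pullFrac}
  [RD.iotaN.range.Normal]
  (h : ModelFrobenioid.Hypotheses tf.divisorMonoid tf.ratFnFunctor) (odd_l : Odd (lv : ℕ))
  (R : (BiKummerSetting.mkOfConnectedTemperoidYdd X tf hZ hP NH RD.toThetaEnvData ιX).NthRoot Rl.root Rl.pair N pullFrac)
  (K' : Type (max u₀ w')) [Field K'] (constEmb : K'ˣ →* tf.biratUnitsModel R.BN) (constEmb_injective : Function.Injective constEmb)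
  (hinvc : ∀ g : Aut R.AN.base,
    pull tf.divisorMonoid g.hom (ModelFrobenioid.div R.pair.num) = ModelFrobenioid.div R.pair.num)
  (hinvp : ∀ y : RD.PiX, y ∈ RD.PiYdd →
    pull tf.divisorMonoid ((BiKummerSetting.mkOfConnectedTemperoidYdd X tf hZ hP NH RD.toThetaEnvData ιX).galoisSurj R.AN.base
      R.αData.isGalois (ιX y)).hom (ModelFrobenioid.div R.pair.den) = ModelFrobenioid.div R.pair.den)

variable {Gal : ConnectedPart (BTemp X.Pi) → Prop}


/-- **`(e, he, hPproj)` DISCHARGED under the projection pin**, in EXACTLY the binder types of abc-iut-L2-t4's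
`cyclotomicRigidity_ofConnectedTemperoidData_of_pullRoot_galois` (p430047) at `Q := RD.levelStub ιX`: there is a SURJECTIVE `e : μ_N → (l·Δ_Θ)_{B_N} ⊗ ℤ/Nℤ` with
`mk (P.proj (ρ k)) = e (thetaMod k)` for every `k ∈ Π^tp_Ÿ ∩ (l·Δ_Θ)` — p440814's record-free coefficient map read on `P` through the pin.
[cite: MochizukiEtTh2009, Prop 5.5 p.327 (PDF p.101); §2 p.46] -/
theorem exists_coeffMap_levelN_of_pin_galois
    (P : ThetaSubquotientProjGalois (ofConnectedTemperoidData h (RD.levelStub ιX) odd_l R ιX K' constEmb constEmb_injective hinvc hinvp) Gal)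
    (hPproj_pin : ∀ (σ : P.pre R.BN.base) (τ : ThetaSubquotient.autPre (RD.qN ιX) RD.iotaN R.BN.base.obj),
      Functor.mapAut R.BN.base (connectedObjects (BTemp X.Pi)).ι (σ : Aut R.BN.base) = (τ : Aut R.BN.base.obj) →
        (P.proj R.BN.base σ : ThetaSubquotient.LDelta (RD.qN ιX) RD.iotaN R.BN.base.obj) =
          ThetaSubquotient.autProj (RD.qN ιX) RD.iotaN R.BN.base.obj τ)
    :
    ∃ e : RD.mu → (ofConnectedTemperoidData h (RD.levelStub ιX) odd_l R ιX K' constEmb constEmb_injective hinvc hinvp).lDeltaModN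
        (ofConnectedTemperoidData h (RD.levelStub ιX) odd_l R ιX K' constEmb constEmb_injective hinvc hinvp).BN,
      Function.Surjective e ∧
        ∀ (k : RD.PiYdd) (hk : (k : RD.PiX) ∈ RD.lDeltaTheta) (hm : rhoOfBiKummerData R ιX k ∈ P.pre _),
          (QuotientGroup.mk (P.proj _ ⟨rhoOfBiKummerData R ιX k, hm⟩) :
              (ofConnectedTemperoidData h (RD.levelStub ιX) odd_l R ιX K' constEmb constEmb_injective hinvc hinvp).lDeltaModN
                (ofConnectedTemperoidData h (RD.levelStub ιX) odd_l R ιX K' constEmb constEmb_injective hinvc hinvp).BN) =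
            e (RD.thetaMod ⟨k, hk⟩) := by
  obtain ⟨e, he, hPe⟩ := exists_coeffMap_autProj_levelN.{u₀, v₀, max u₀ w'} (hZ := hZ) (hP := hP) (NH := NH) R ιX
  refine ⟨e, he, fun k hk hm => ?_⟩
  have hm' : ((Functor.mapAut R.BN.base (connectedObjects (BTemp X.Pi)).ι).comp (rhoOfBiKummerData R ιX)) k ∈
      ThetaSubquotient.autPre (RD.qN ιX) RD.iotaN R.BN.base.obj :=
    mapAut_rho_mem_autPre_of_coe_mem_lDeltaTheta R ιX k hk
  have hpin := hPproj_pin ⟨rhoOfBiKummerData R ιX k, hm⟩ ⟨_, hm'⟩ rfl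
  exact (congrArg QuotientGroup.mk hpin).trans (hPe k hk hm')

/-- (v2 record `ThetaSubquotientProjGalois`; the v1 theorem `hproj_levelN_of_pin`, its one-line proof routed through this seat's `hproj_levelStub_of_pins_galois` — the v1 tree carries the `B_N^bs`-spelled lemma twice (`hproj_levelN_of_pin_base` ≡ abc-iut-w4-d042's `hproj_levelStub_of_pins`); the v2 record keeps ONE.) **The structural leaf `hproj` DISCHARGED under the two pins** — p430047's binder type verbatim (`Aut_D(B_N^bs)` spelled `Aut (𝔉.base.obj 𝔉.BN)`).
[cite: MochizukiEtTh2009, Prop 5.5 p.327–328 (PDF pp.101–102)] -/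
theorem hproj_levelN_of_pin_galois
    (P : ThetaSubquotientProjGalois (ofConnectedTemperoidData h (RD.levelStub ιX) odd_l R ιX K' constEmb constEmb_injective hinvc hinvp) Gal)
    (hPpre : P.pre R.BN.base =
      (ThetaSubquotient.autPre (RD.qN ιX) RD.iotaN R.BN.base.obj).comap (Functor.mapAut R.BN.base (connectedObjects (BTemp X.Pi)).ι))
    (hPproj_pin : ∀ (σ : P.pre R.BN.base) (τ : ThetaSubquotient.autPre (RD.qN ιX) RD.iotaN R.BN.base.obj),
      Functor.mapAut R.BN.base (connectedObjects (BTemp X.Pi)).ι (σ : Aut R.BN.base) = (τ : Aut R.BN.base.obj) →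
        (P.proj R.BN.base σ : ThetaSubquotient.LDelta (RD.qN ιX) RD.iotaN R.BN.base.obj) =
          ThetaSubquotient.autProj (RD.qN ιX) RD.iotaN R.BN.base.obj τ)
    :
    ∀ (g g' : Aut ((ofConnectedTemperoidData h (RD.levelStub ιX) odd_l R ιX K' constEmb constEmb_injective hinvc hinvp).base.obj
        (ofConnectedTemperoidData h (RD.levelStub ιX) odd_l R ιX K' constEmb constEmb_injective hinvc hinvp).BN))
      (hh : g' ∈ P.pre _), ∃ hgh : g * g' * g⁻¹ ∈ P.pre _,
        (ofConnectedTemperoidData h (RD.levelStub ιX) odd_l R ιX K' constEmb constEmb_injective hinvc hinvp).lDeltaMap g.hom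
            (P.proj _ ⟨g', hh⟩) = P.proj _ ⟨g * g' * g⁻¹, hgh⟩ :=
  fun g g' hh => hproj_levelStub_of_pins_galois.{u₀, v₀, w'} h odd_l R ιX K' constEmb constEmb_injective hinvc hinvp P hPpre hPproj_pin g g' hh

end LevelNPin

end ThetaFrobenioid

end Literature.AnabelianGeometry.EtaleTheta

end
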